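import Summits.BirchSwinnertonDyer.Rank1Residual.GaloisImage.KolyvaginFiniteSingularRat
import Summits.BirchSwinnertonDyer.Rank1Residual.GaloisImage.CyclotomicLevelInertiaGenerators
import HarnessLib

/-!
# THEOREM C of row T-DER for `T_p E / ℚ` at an ARBITRARY inertia lift of the generator
# (cell `b2b-bsdres`, n1011 p11 GEN 9; sequel of `KolyvaginFiniteSingularRat`)

HONEST FRAMING (cell `b2b-bsdres`, run/shared/lean/b2b/bsd-rank1-residual/, verbatim in every
file): the goal of the cell is to DELETE the COMBINATION-SHAPED residual classes of the
Birch–Swinnerton-Dyer formula for ALL analytic-rank `≤ 1` elliptic curves over `ℚ` — "full BSD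
formula for every rank `≤ 1` curve in class `C`" assembled STRICTLY from published theorems — so
that the rank-`≤ 1` remainder becomes exactly the CONSTRUCTION-SHAPED classes, which are TYPED
(missing-input `Prop`s), NOT attempted. This is not "finishing BSD". Team n1011: research route on
the CONSTRUCTION-SHAPED class X4 / §I N11 (route-1 PORT, (P-DER)); TOOL theorem: NO Euler system is
asserted to exist (it is the hypothesis `hc`), no definition, no named fact, no `sorry`.

## What

The tree's predicate `IsFiniteSingularComparisonWith ρ N fs φ τ` (Rubin PCMI Def. 1.9.6 in Kim's
generator-fixed form, `Literature/…/FiniteSingularComparison.lean`) reads the relation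
`w(τ) = Q(φ⁻¹)·z(φ)` at EVERY inertia element `τ` restricting to the fixed generator of
`Gal(ℚ_q(μ_q)/ℚ_q)`, whereas THEOREM C (`apply_sigma_eq_aeval_apply_of_eulerSystem`) evaluates at
the generator `σ_q ∈ I_𝔔` used to build `D_q`.  This file closes the gap:
* `apply_eq_zero_of_mem_inertia_of_resSubgroup_eq` — a cocycle `Φ : Γ_ℚ → T′` whose class
  restricts on an open normal `U` into the image of `red_* : H¹(U, T_pE) → H¹(U, T′)` VANISHES on
  `I_𝔔 ∩ U` (`𝔔 ∣ q`, `q ∤ p` good) as soon as `T′` is unramified at `𝔔`: `Φ|_U = red ∘ x + ∂e`,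
  `x(I_𝔔 ∩ U) = 0` by E1 (`Inertia.apply_eq_zero_of_mem_inertia_of_mem_tate`: the weights of
  Frobenius on `T_pE`), `∂e(u) = u e − e = 0`;
* `apply_eq_aeval_apply_of_mem_inertia_of_eulerSystem` — THEOREM C with `σ_q` replaced by ANY
  `τ ∈ I_𝔔` with `σ_q⁻¹ τ ∈ Gal(ℚ̄/ℚ(μ_q))` (same action on `μ_q`), for `T′` unramified at `𝔔`
  (`hX'I`, replacing `hX'σ`): `Φ(τ) = Φ(σ_q) + σ_q Φ(σ_q⁻¹ τ) = Φ(σ_q)` since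
  `σ_q⁻¹ τ ∈ I_𝔔 ∩ Gal(ℚ̄/ℚ(μ_{rq}))` (inertia at `q` fixes `μ_ℓ`, `ℓ ≠ q`:
  `CyclotomicLevel.Rat.mem_tameLevel_of_mem_inertia`).
0 defs, 0 facts.  References: K. Rubin, PCMI 18 (2011), Def. 1.9.4, Def. 1.9.6, Prop. 1.9.5;
K. Rubin, *Euler Systems* (2000), Thm. 4.5.4; C.-H. Kim, arXiv:2203.12159, §2.1.2–§2.2.2.
-/

noncomputable section

open CategoryTheory Function Finset Polynomial Field IsDedekindDomain
open scoped NumberField Pointwise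
open Literature.NumberTheory.GaloisRepresentations Literature.NumberTheory.EllipticCurves
open Literature.NumberTheory.EllipticCurves (subgroupInclusion subgroupInclusion_apply_coe
  subgroupConj subgroupConj_apply_coe)
open Summit.BirchSwinnertonDyer.Rank1Residual.GaloisImage.CyclotomicLevel
open Rat.HeightOneSpectrum

universe u

namespace Summit.BirchSwinnertonDyer.Rank1Residual.GaloisImage.Derivative.Rat

variable (W : WeierstrassCurve ℚ) [W.IsElliptic] [W.IsGloballyMinimal] (p : ℕ) [Fact p.Prime]
variable [Module.Free ℤ_[p] (W.tateModule p)] [Module.Finite ℤ_[p] (W.tateModule p)]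
  [ContinuousSMul ℤ_[p] (W.tateModule p)]

/-- Local notation: `T∞ = T_p E` as a continuous `G_ℚ`-representation. -/
local notation3 "T∞" => WeierstrassCurve.tateGaloisRep W p (W.continuous_galoisRepTate_holds p)

/-- Local notation: `𝐫⟦f, T′, U⟧ = f_* : H¹(U, T_pE) → H¹(U, T′)`. -/
local notation3 (prettyPrint := false) "𝐫⟦" f ", " Tg ", " U "⟧" =>
  ContinuousCohomology.map (ContinuousMonoidHom.id _)
    (X := subgroupRep (ContinuousRep.toTopRep T∞) U)
    (Y := subgroupRep (ContinuousRep.toTopRep Tg) U)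
    ((TopRep.resFunctor (Subgroup.subtype U)).map f) 1

omit [W.IsGloballyMinimal] [Module.Free ℤ_[p] (W.tateModule p)]
  [Module.Finite ℤ_[p] (W.tateModule p)] in
/-- **A reduced `T_pE`-class kills inertia.**  Let `U ≤ Γ_ℚ` be open and normal, `q ∤ p` a place
of good reduction, `𝔔 ∣ q`, `red : T_pE ⟶ T′` with `T′` unramified at `𝔔` (`hX'I`).  If the class
of `Φ : Γ_ℚ → T′` restricts on `U` to `red_* x` for some `x ∈ H¹(U, T_pE)`, then `Φ(u) = 0` for
every `u ∈ I_𝔔 ∩ U`: `Φ|_U = red ∘ x̃ + ∂e` with `x̃(u) = 0` (E1, the weights of Frobenius on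
`T_pE`) and `∂e(u) = u·e − e = 0`. [cite: Rubin2000, Lemma 4.7.3 / Thm. 4.5.4 (proof)] -/
theorem apply_eq_zero_of_mem_inertia_of_resSubgroup_eq {U : Subgroup (absoluteGaloisGroup ℚ)}
    [U.Normal] (hU : IsOpen (U : Set (absoluteGaloisGroup ℚ))) {q : HeightOneSpectrum (𝓞 ℚ)}
    (hpv : ((p : ℕ) : 𝓞 ℚ) ∉ q.asIdeal) (hgood : W.HasGoodReductionAt q)
    {𝔔 : Ideal (absIntegers (𝓞 ℚ) ℚ)} (h𝔔 : 𝔔 ∈ q.primesAbove)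
    {M' : Type} [AddCommGroup M'] [Module ℤ_[p] M'] [TopologicalSpace M'] [IsTopologicalAddGroup M']
    [ContinuousSMul ℤ_[p] M'] {T' : GaloisRep ℚ ℤ_[p] M'} (red : T∞.toTopRep ⟶ T'.toTopRep)
    (hX'I : ∀ u ∈ 𝔔.inertia (absoluteGaloisGroup ℚ), ∀ w : M', T'.toTopRep.ρ u w = w)
    (x : continuousCohomology 1 (subgroupRep T∞.toTopRep U)) (Φ : contOneCocycles T'.toTopRep)
    (hΦ : resSubgroup T'.toTopRep U 1 (oneCocycleClass _ Φ) = 𝐫⟦red, T', U⟧ x)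
    {u : absoluteGaloisGroup ℚ} (huI : u ∈ 𝔔.inertia (absoluteGaloisGroup ℚ)) (huU : u ∈ U) :
    Φ.1 u = 0 := by
  obtain ⟨xt, rfl⟩ := oneCocycleClass_surjective _ x
  rw [red_oneCocycleClass red U xt, resSubgroup_oneCocycleClass] at hΦ
  obtain ⟨e, he⟩ := Congruence.exists_forall_apply_eq_add_of_oneCocycleClass_eq T'.toTopRep _ _ hΦ
  have h1 : Φ.1 u = red.hom (xt.1 ⟨u, huU⟩) + (T'.toTopRep.ρ u e - e) := he ⟨u, huU⟩
  rw [h1, Inertia.apply_eq_zero_of_mem_inertia_of_mem_tate W p _ hU hpv hgood xt h𝔔 huI huU,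
    map_zero, zero_add, hX'I u huI e, sub_self]

variable (S : Set (HeightOneSpectrum (𝓞 ℚ)))

/-- Local notation: `𝓛` = the cyclotomic Euler-system levels `ℚ(μ_{p^{n+1}}, μ_r)`, `r ∩ S = ∅`. -/
local notation3 "𝓛" => cyclotomicLevelsRat p S

/-- Local notation: `𝐃⟦X, U, τ⟧ ℓ = ∑_{j < ℓ−1} j·(τ_ℓ)_*^j`, Kolyvagin's derivative operator of the
place `ℓ` on `H¹(U, X)` for the generator `τ_ℓ`. -/
local notation3 (prettyPrint := false) "𝐃⟦" X ", " U ", " τ "⟧" =>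
  fun ℓ : HeightOneSpectrum (𝓞 ℚ) =>
  ∑ j ∈ Finset.range (((primesEquiv ℓ : Nat.Primes) : ℕ) - 1),
    (j : Module.End ℤ_[p] (continuousCohomology 1 (subgroupRep X U))) *
      (conjMap X U ((τ : HeightOneSpectrum (𝓞 ℚ) → absoluteGaloisGroup ℚ) ℓ) 1).hom.toLinearMap ^ j

/-- Local notation: `𝐏⟦φ⟧ = P(φ⁻¹ | T_pE^*; X) = det(1 − φ⁻¹X | T_pE ⊗ χ_cyc)`, Rubin's Euler
factor. -/
local notation3 "𝐏⟦" φ "⟧" =>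
  rubinEulerFactor (WeierstrassCurve.galoisRepTate W p) (cyclotomicCharacterToUnits ℚ p ℤ_[p]) φ

/-- **THEOREM C for `T_p E` over `ℚ` at any inertia lift of the generator** ([Rubin00]
Thm. 4.5.4 with [Rubin2011] Def. 1.9.6): in the situation of
`apply_sigma_eq_aeval_apply_of_eulerSystem` (see that docstring), with `T′` UNRAMIFIED at `𝔔`
(`hX'I`), for every `τ ∈ I_𝔔` acting on `μ_q` as `σ_q` does (`σ_q⁻¹ τ ∈ Gal(ℚ̄/ℚ(μ_q))`) and all
representatives `Φ ∈ κ′`, `Φ_r ∈ κ`: **`Φ(τ) = Q(φ⁻¹) · Φ_r(φ)`**.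
[cite: Rubin2000, Thm. 4.5.4] [cite: Rubin2011, Def. 1.9.6 (p. 14)] -/
theorem apply_eq_aeval_apply_of_mem_inertia_of_eulerSystem (hp2 : p ≠ 2)
    {c : ∀ (i : ℕ) (r : (𝓛).Ideals), H1 T∞ ((𝓛).level i r.1)}
    (hc : IsEulerSystem 𝓛 T∞ p c)
    {M' : Type} [AddCommGroup M'] [Module ℤ_[p] M'] [TopologicalSpace M'] [IsTopologicalAddGroup M']
    [ContinuousSMul ℤ_[p] M'] {T' : GaloisRep ℚ ℤ_[p] M'} (red : T∞.toTopRep ⟶ T'.toTopRep)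
    {k : ℕ} (hk : 0 < k) (hM : ∀ m : M', ((p : ℤ_[p]) ^ k) • m = 0)
    (r : (𝓛).Ideals) {q : HeightOneSpectrum (𝓞 ℚ)} (hq : q ∈ (𝓛).primes) (hqr : q ∉ r.1)
    (hKol : Kato.IsKolyvaginPrime W p k ((primesEquiv q : Nat.Primes) : ℕ))
    (σ : HeightOneSpectrum (𝓞 ℚ) → absoluteGaloisGroup ℚ)
    (hσ : ∀ ℓ ∈ (r.cons q hq).1, ∀ ℓ₂ ∈ (r.cons q hq).1, ℓ₂ ≠ ℓ → σ ℓ ∈ (𝓛).tameLevel ℓ₂)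
    (hcov : ∀ ℓ ∈ (r.cons q hq).1, ∀ g : absoluteGaloisGroup ℚ,
      ∃ j < ((primesEquiv ℓ : Nat.Primes) : ℕ) - 1, (σ ℓ ^ j)⁻¹ * g ∈ (𝓛).tameLevel ℓ)
    (hinj : ∀ ℓ ∈ (r.cons q hq).1, ∀ j₁ < ((primesEquiv ℓ : Nat.Primes) : ℕ) - 1,
      ∀ j₂ < ((primesEquiv ℓ : Nat.Primes) : ℕ) - 1,
        (σ ℓ ^ j₁)⁻¹ * σ ℓ ^ j₂ ∈ (𝓛).tameLevel ℓ → j₁ = j₂)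
    {𝔔 : Ideal (absIntegers (𝓞 ℚ) ℚ)} (h𝔔 : 𝔔 ∈ q.primesAbove)
    (hσI : σ q ∈ 𝔔.inertia (absoluteGaloisGroup ℚ))
    {φ : absoluteGaloisGroup ℚ} (hφ : IsArithFrobAt (𝓞 ℚ) φ 𝔔) (hφq : φ ∈ (𝓛).tameLevel q)
    (h0 : ∀ v : T'.toTopRep,
      (∀ u : ((𝓛).level ⊥ (r.cons q hq).1), T'.toTopRep.ρ (u : absoluteGaloisGroup ℚ) v = v) →
        v = 0)
    (hX'I : ∀ u ∈ 𝔔.inertia (absoluteGaloisGroup ℚ), ∀ w : M', T'.toTopRep.ρ u w = w)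
    (hPX : ∀ w : M', aeval ((T'.toTopRep.ρ φ⁻¹ : M' →L[ℤ_[p]] M') : Module.End ℤ_[p] M')
      𝐏⟦φ⟧ w = 0)
    (Q : ℤ_[p][X]) (hQ : (Polynomial.X - C 1) * Q = 𝐏⟦φ⟧ - C (𝐏⟦φ⟧.eval 1))
    (comm') (κ' : continuousCohomology 1 T'.toTopRep)
    (hκ' : resSubgroup T'.toTopRep ((𝓛).level ⊥ (r.cons q hq).1) 1 κ' =
      ((r.cons q hq).1.noncommProd 𝐃⟦T'.toTopRep, ((𝓛).level ⊥ (r.cons q hq).1), σ⟧ comm')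
        (𝐫⟦red, T', ((𝓛).level ⊥ (r.cons q hq).1)⟧ (c ⊥ (r.cons q hq))))
    (comm) (κ : continuousCohomology 1 T'.toTopRep)
    (hκ : resSubgroup T'.toTopRep ((𝓛).level ⊥ r.1) 1 κ =
      (r.1.noncommProd 𝐃⟦T'.toTopRep, ((𝓛).level ⊥ r.1), σ⟧ comm)
        (𝐫⟦red, T', ((𝓛).level ⊥ r.1)⟧ (c ⊥ r)))
    (Φ : contOneCocycles T'.toTopRep) (hΦ : oneCocycleClass _ Φ = κ')
    (Φr : contOneCocycles T'.toTopRep) (hΦr : oneCocycleClass _ Φr = κ)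
    {τ : absoluteGaloisGroup ℚ} (hτ : τ ∈ 𝔔.inertia (absoluteGaloisGroup ℚ))
    (hτσ : (σ q)⁻¹ * τ ∈ (𝓛).tameLevel q) :
    Φ.1 τ = aeval ((T'.toTopRep.ρ φ⁻¹ : M' →L[ℤ_[p]] M') : Module.End ℤ_[p] M') Q (Φr.1 φ) := by
  classical
  -- THEOREM C at the generator `σ_q`
  have hC := apply_sigma_eq_aeval_apply_of_eulerSystem W S hp2 hc red hk hM r hq hqr hKol σ hσ hcov
    hinj h𝔔 hσI hφ hφq h0 (fun w => hX'I _ hσI w) hPX Q hQ comm' κ' hκ' comm κ hκ Φ hΦ Φr hΦr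
  -- the Kolyvagin prime
  have hq'p : ((primesEquiv q : Nat.Primes) : ℕ).Prime := (primesEquiv q).2
  have hne : ((primesEquiv q : Nat.Primes) : ℕ) ≠ p := hKol.ne
  have hgood : W.HasGoodReductionAt q :=
    CyclotomicLevel.Rat.hasGoodReductionAt_of_isKolyvaginPrime W hKol
  have hpv : ((p : ℕ) : 𝓞 ℚ) ∉ q.asIdeal :=
    Rat.natCast_not_mem_asIdeal_of_not_dvd fun h =>
      hne ((Nat.prime_dvd_prime_iff_eq hq'p (Fact.out : p.Prime)).mp h)
  -- `u := σ_q⁻¹ τ ∈ I_𝔔 ∩ Gal(ℚ̄/ℚ(μ_{rq}))`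
  have hqins : q ∈ (r.cons q hq).1 := Finset.mem_insert_self q r.1
  have hrins : ∀ ℓ ∈ r.1, ℓ ∈ (r.cons q hq).1 := fun ℓ hℓ => Finset.mem_insert_of_mem hℓ
  have hrq : ∀ ℓ ∈ r.1, ℓ ≠ q := fun ℓ hℓ h => hqr (h ▸ hℓ)
  have huI : (σ q)⁻¹ * τ ∈ 𝔔.inertia (absoluteGaloisGroup ℚ) :=
    Subgroup.mul_mem _ (Subgroup.inv_mem _ hσI) hτ
  have huU : (σ q)⁻¹ * τ ∈ ((𝓛).level ⊥ (r.cons q hq).1) := by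
    change (σ q)⁻¹ * τ ∈ (𝓛).level ⊥ (insert q r.1)
    refine mem_level_of_forall 𝓛 (by rw [(𝓛).pLevel_bot]; exact Subgroup.mem_top _)
      fun ℓ hℓ => ?_
    rcases Finset.mem_insert.mp hℓ with rfl | hℓ
    · exact hτσ
    · exact Subgroup.mul_mem _ (Subgroup.inv_mem _ (hσ q hqins ℓ (hrins ℓ hℓ) (hrq ℓ hℓ)))
        (CyclotomicLevel.Rat.mem_tameLevel_of_mem_inertia p S h𝔔 hτ (hrq ℓ hℓ))
  -- `res κ′ = red_* (D_{rq} c_{rq})` at the `T`-level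
  have commT : (((r.cons q hq).1 : Finset _) : Set (HeightOneSpectrum (𝓞 ℚ))).Pairwise fun a b =>
      Commute (𝐃⟦T∞.toTopRep, ((𝓛).level ⊥ (r.cons q hq).1), σ⟧ a)
        (𝐃⟦T∞.toTopRep, ((𝓛).level ⊥ (r.cons q hq).1), σ⟧ b) :=
    pairwise_commute_deriv (T' := T∞) ⊥ (r.cons q hq).1 σ
      (fun ℓ => ((primesEquiv ℓ : Nat.Primes) : ℕ) - 1)
  have hres : resSubgroup T'.toTopRep ((𝓛).level ⊥ (r.cons q hq).1) 1 (oneCocycleClass _ Φ) =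
      𝐫⟦red, T', ((𝓛).level ⊥ (r.cons q hq).1)⟧
        (((r.cons q hq).1.noncommProd 𝐃⟦T∞.toTopRep, ((𝓛).level ⊥ (r.cons q hq).1), σ⟧ commT)
          (c ⊥ (r.cons q hq))) := by
    rw [hΦ, hκ']
    exact (apply_noncommProd_apply_eq_of_comm
      (𝐫⟦red, T', ((𝓛).level ⊥ (r.cons q hq).1)⟧).hom.toLinearMap (r.cons q hq).1 commT comm'
      (fun ℓ _ v => apply_deriv_apply_eq_of_comm _ (fun w => red_conjMap red (σ ℓ) w) _ v)
      (c ⊥ (r.cons q hq))).symm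
  have h0u : Φ.1 ((σ q)⁻¹ * τ) = 0 :=
    apply_eq_zero_of_mem_inertia_of_resSubgroup_eq W p ((𝓛).isOpen_level ⊥ _) hpv hgood h𝔔 red
      hX'I _ Φ hres huI huU
  -- `Φ(τ) = Φ(σ_q) + σ_q Φ(σ_q⁻¹ τ) = Φ(σ_q)`
  calc Φ.1 τ = Φ.1 (σ q * ((σ q)⁻¹ * τ)) := by rw [mul_inv_cancel_left]
    _ = Φ.1 (σ q) + T'.toTopRep.ρ (σ q) (Φ.1 ((σ q)⁻¹ * τ)) := Φ.2 _ _
    _ = Φ.1 (σ q) := by rw [h0u, map_zero, add_zero]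
    _ = _ := hC

end Summit.BirchSwinnertonDyer.Rank1Residual.GaloisImage.Derivative.Rat

end
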